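import Literature.ComputerArithmetic.JeannerodRump2018.Summation
import Mathlib.Data.Int.Log
import Mathlib.Algebra.Order.Floor.Ring
import Mathlib.Data.Rat.Floor
import Mathlib.Tactic.Linarith
import Mathlib.Tactic.FieldSimp

/-!
# Jeannerod–Rump: the optimal relative error bound `u/(1+u)` for floating-point ADDITION (proved)

HONEST FRAMING (venture CertifiedArithmetic / cell `pub-lowprec`): certified error envelopes and
provably optimal rounding/accumulation schemes for low-precision formats under stated cost models;
every table by two implementations; no hardware or vendor claims.

In the setting of `Summation.lean` (`F` = `IsFloat p emin`: precision `p`, gradual underflow from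
exponent `emin`, no overflow; `fl` ANY round-to-nearest map into `F`), we PROVE the two local facts
used by [JeannerodRump2018, §4 and Appendix B] for a floating-point addition `fl(a + b)`,
`a, b ∈ F`:
* `abs_err_add_le_sharp`: `|fl(a+b) - (a+b)| ≤ u/(1+u) · |a+b|` — the optimal bound `E₁(t) ≤
  u/(1+u)` of [JeannerodRump2018, eq. (1.2)/(4.1)] specialised to sums of two floats, which holds
  EVEN WITH UNDERFLOW because a sum of two floats below `2^(emin+p)` is itself a float;
* `abs_err_le_abs_operand`: `|fl(a+b) - (a+b)| ≤ |b|` (and `≤ |a|`) — [JeannerodRump2018, App. B,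
  citing Jeannerod–Rump 2013 Lemma 2.2]: `a ∈ F` is a rounding candidate.
These feed the proof of Theorem 4.1 in `Theorem41.lean`.
-/

namespace Literature.ComputerArithmetic.JeannerodRump2018

/-! ### Elementary facts about `F` -/

/-- `0 ∈ F`. [cite: JeannerodRump2018, §1] -/
theorem isFloat_zero (p : ℕ) (emin : ℤ) : IsFloat p emin 0 :=
  ⟨0, emin, by simp, le_rfl, by simp⟩

/-- `F` is symmetric. [cite: JeannerodRump2018, §1] -/
theorem IsFloat.neg {p : ℕ} {emin : ℤ} {x : ℚ} (h : IsFloat p emin x) : IsFloat p emin (-x) := by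
  obtain ⟨M, e, hM, he, rfl⟩ := h
  exact ⟨-M, e, by simpa using hM, he, by push_cast; ring⟩

/-- An integer multiple `N · 2^e` of a power `2^e`, `e ≥ emin`, with `|N| < 2^p` is in `F`.
[cite: JeannerodRump2018, §1] -/
theorem isFloat_of_int_mul {p : ℕ} {emin : ℤ} (N e : ℤ) (hN : |N| < 2 ^ p) (he : emin ≤ e) :
    IsFloat p emin ((N : ℚ) * (2 : ℚ) ^ e) :=
  ⟨N, e, hN, he, rfl⟩

/-- A float is an integer multiple of `2^emin`. [cite: JeannerodRump2018, §1] -/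
theorem IsFloat.exists_int_mul_zpow_emin {p : ℕ} {emin : ℤ} {x : ℚ} (h : IsFloat p emin x) :
    ∃ N : ℤ, x = (N : ℚ) * (2 : ℚ) ^ emin := by
  obtain ⟨M, e, -, he, rfl⟩ := h
  obtain ⟨d, hd⟩ := Int.eq_ofNat_of_zero_le (sub_nonneg.mpr he)
  refine ⟨M * 2 ^ d, ?_⟩
  rw [show e = emin + (d : ℤ) by omega, zpow_add₀ (by norm_num : (2 : ℚ) ≠ 0), zpow_natCast]
  push_cast; ring

/-- The sum of two floats is an integer multiple of `2^emin`. [cite: JeannerodRump2018, App. B] -/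
theorem exists_int_add {p : ℕ} {emin : ℤ} {a b : ℚ} (ha : IsFloat p emin a) (hb : IsFloat p emin b) :
    ∃ N : ℤ, a + b = (N : ℚ) * (2 : ℚ) ^ emin := by
  obtain ⟨Na, ha'⟩ := ha.exists_int_mul_zpow_emin
  obtain ⟨Nb, hb'⟩ := hb.exists_int_mul_zpow_emin
  exact ⟨Na + Nb, by rw [ha', hb']; push_cast; ring⟩

/-- GRADUAL UNDERFLOW: a sum of two floats of magnitude `< 2^(emin + p)` is itself a float (hence
rounds without error). [cite: JeannerodRump2018, Thm 4.1 (remark: holds with underflow)] -/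
theorem isFloat_add_of_small {p : ℕ} {emin : ℤ} {a b : ℚ} (ha : IsFloat p emin a)
    (hb : IsFloat p emin b) (hsmall : |a + b| < (2 : ℚ) ^ (emin + p)) : IsFloat p emin (a + b) := by
  obtain ⟨N, hN⟩ := exists_int_add ha hb
  rw [hN]
  refine isFloat_of_int_mul N emin ?_ le_rfl
  have h2 : (0 : ℚ) < (2 : ℚ) ^ emin := zpow_pos (by norm_num) _
  rw [hN, abs_mul, abs_of_pos h2, zpow_add₀ (by norm_num : (2:ℚ) ≠ 0), zpow_natCast, mul_comm] at hsmall
  have : |(N : ℚ)| < 2 ^ p := lt_of_mul_lt_mul_left hsmall h2.le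
  exact_mod_cast this

/-! ### Round-to-nearest: basic consequences -/

/-- A rounding candidate bounds the error: for `f ∈ F`, `|t - fl t| ≤ |t - f|`.
[cite: JeannerodRump2018, §1 eq. (1.1)] -/
theorem abs_sub_fl_le {p : ℕ} {emin : ℤ} {fl : ℚ → ℚ} (hfl : IsRoundNearest p emin fl) (t : ℚ)
    {f : ℚ} (hf : IsFloat p emin f) : |t - fl t| ≤ |t - f| :=
  (hfl t).2 f hf

/-- Floats are fixed by `fl`. [cite: JeannerodRump2018, §1] -/
theorem fl_eq_self {p : ℕ} {emin : ℤ} {fl : ℚ → ℚ} (hfl : IsRoundNearest p emin fl) {t : ℚ}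
    (ht : IsFloat p emin t) : fl t = t := by
  have h := abs_sub_fl_le hfl t ht
  rw [sub_self, abs_zero] at h
  have := abs_eq_zero.mp (le_antisymm h (abs_nonneg _))
  linarith

/-- ERROR ≤ OPERAND: for `a, b ∈ F`, `|fl(a+b) - (a+b)| ≤ |b|` (since `a` is a candidate).
[cite: JeannerodRump2018, App. B] -/
theorem abs_err_le_abs_operand {p : ℕ} {emin : ℤ} {fl : ℚ → ℚ} (hfl : IsRoundNearest p emin fl)
    {a : ℚ} (ha : IsFloat p emin a) (b : ℚ) : |fl (a + b) - (a + b)| ≤ |b| := by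
  have h := abs_sub_fl_le hfl (a + b) ha
  rw [abs_sub_comm] at h
  simpa using h

/-- The mirrored rounding `t ↦ -fl(-t)` is also a round-to-nearest into `F`.
[cite: JeannerodRump2018, §1] -/
theorem IsRoundNearest.neg {p : ℕ} {emin : ℤ} {fl : ℚ → ℚ} (hfl : IsRoundNearest p emin fl) :
    IsRoundNearest p emin (fun t => -fl (-t)) := by
  intro t
  refine ⟨(hfl (-t)).1.neg, fun f hf => ?_⟩
  have h := (hfl (-t)).2 (-f) hf.neg
  rw [show |t - -fl (-t)| = |-t - fl (-t)| by rw [← abs_neg]; ring_nf]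
  rwa [show |(-t) - (-f)| = |t - f| by rw [← abs_neg]; ring_nf] at h

/-! ### The optimal bound for addition -/

/-- Normal-range case, positive argument: if `2^(emin+p) ≤ t` then `|t - fl t| ≤ u/(1+u)·t`.
[cite: JeannerodRump2018, eq. (1.2)] -/
theorem abs_sub_fl_le_sharp_pos {p : ℕ} {emin : ℤ} {fl : ℚ → ℚ} (hp : 1 ≤ p)
    (hfl : IsRoundNearest p emin fl) {t : ℚ} (ht : (2 : ℚ) ^ (emin + p) ≤ t) :
    |t - fl t| ≤ unitRoundoff p / (1 + unitRoundoff p) * t := by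
  have h2 : (2 : ℚ) ≠ 0 := by norm_num
  have htpos : 0 < t := lt_of_lt_of_le (zpow_pos (by norm_num) _) ht
  -- binade: 2^k ≤ t < 2^(k+1)
  set k := Int.log 2 t with hk
  have hlow : ((2 : ℕ) : ℚ) ^ k ≤ t := Int.zpow_log_le_self (by norm_num) htpos
  have hup : t < ((2 : ℕ) : ℚ) ^ (k + 1) := Int.lt_zpow_succ_log_self (by norm_num) t
  push_cast at hlow hup
  -- k ≥ emin + p
  have hk_ge : emin + p ≤ k := by
    by_contra hlt
    have hlt : k + 1 ≤ emin + p := by omega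
    have : (2 : ℚ) ^ (k + 1) ≤ (2 : ℚ) ^ (emin + (p : ℤ)) := zpow_le_zpow_right₀ (by norm_num) hlt
    linarith
  -- spacing c = 2^(k+1-p), floor multiple m
  set c : ℚ := (2 : ℚ) ^ (k + 1 - p) with hc
  have hcpos : 0 < c := zpow_pos (by norm_num) _
  have hg : (2 : ℚ) ^ k = (2 : ℚ) ^ ((p : ℤ) - 1) * c := by
    rw [hc, ← zpow_add₀ h2]; congr 1; ring
  have hg2 : (2 : ℚ) ^ (k + 1) = (2 : ℚ) ^ (p : ℤ) * c := by
    rw [hc, ← zpow_add₀ h2]; congr 1; ring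
  set m := ⌊t / c⌋ with hm
  have hm_le : (m : ℚ) ≤ t / c := Int.floor_le _
  have hm_lt : t / c < m + 1 := Int.lt_floor_add_one _
  have hpz : (2 : ℚ) ^ ((p : ℤ) - 1) = ((2 ^ (p - 1) : ℕ) : ℤ) := by
    rw [show ((p : ℤ) - 1) = ((p - 1 : ℕ) : ℤ) by omega, zpow_natCast]; push_cast; ring
  have hpz' : (2 : ℚ) ^ (p : ℤ) = ((2 ^ p : ℕ) : ℤ) := by rw [zpow_natCast]; push_cast; ring
  -- 2^(p-1) ≤ m < 2^p
  have hm_ge : (2 ^ (p - 1) : ℤ) ≤ m := by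
    rw [hm, Int.le_floor]; push_cast
    rw [le_div_iff₀ hcpos]
    have : ((2 : ℕ) : ℚ) ^ (p - 1) * c = (2 : ℚ) ^ k := by
      rw [hg, show ((p : ℤ) - 1) = ((p - 1 : ℕ) : ℤ) by omega, zpow_natCast]; push_cast; ring
    push_cast at this; linarith
  have hm_lt' : m < (2 ^ p : ℤ) := by
    rw [hm, Int.floor_lt]; push_cast
    rw [div_lt_iff₀ hcpos]
    have : ((2 : ℕ) : ℚ) ^ p * c = (2 : ℚ) ^ (k + 1) := by rw [hg2, zpow_natCast]; push_cast; ring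
    push_cast at this; linarith
  -- the two neighbouring floats f1 = m c and f2 = (m+1) c
  have hf1 : IsFloat p emin ((m : ℚ) * c) := by
    refine ⟨m, k + 1 - p, ?_, by omega, rfl⟩
    rw [abs_of_nonneg (by linarith [show (0:ℤ) ≤ 2 ^ (p-1) from by positivity])]
    exact_mod_cast hm_lt'
  have hf2 : IsFloat p emin (((m + 1 : ℤ) : ℚ) * c) := by
    rcases lt_or_eq_of_le (Int.add_one_le_iff.mpr hm_lt') with hlt | heq
    · refine ⟨m + 1, k + 1 - p, ?_, by omega, rfl⟩
      rw [abs_of_nonneg (by linarith [show (0:ℤ) ≤ 2 ^ (p-1) from by positivity])]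
      exact_mod_cast hlt
    · -- m + 1 = 2^p: f2 = 2^(k+1) = 2^(p-1) · 2^(k+2-p)
      refine ⟨2 ^ (p - 1), k + 2 - p, ?_, by omega, ?_⟩
      · rw [abs_of_nonneg (by positivity)]
        exact_mod_cast Nat.pow_lt_pow_right (by norm_num) (by omega : p - 1 < p)
      · rw [heq]; push_cast
        rw [show (k + 2 - (p : ℤ)) = (k + 1 - p) + 1 by ring, zpow_add₀ h2, zpow_one, ← hc,
          show ((2 : ℚ) ^ p : ℚ) = 2 ^ (p - 1) * 2 by
            rw [← pow_succ]; congr 1; omega]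
        ring
  -- the binade start g = 2^k is a float
  have hgF : IsFloat p emin ((2 : ℚ) ^ k) := by
    refine ⟨2 ^ (p - 1), k + 1 - p, ?_, by omega, ?_⟩
    · rw [abs_of_nonneg (by positivity)]
      exact_mod_cast Nat.pow_lt_pow_right (by norm_num) (by omega : p - 1 < p)
    · rw [hg, show ((p : ℤ) - 1) = ((p - 1 : ℕ) : ℤ) by omega, zpow_natCast]; push_cast; ring
  -- error bounds
  have e1 := abs_sub_fl_le hfl t hf1
  have e2 := abs_sub_fl_le hfl t hf2
  have eg := abs_sub_fl_le hfl t hgF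
  have hf1le : (m : ℚ) * c ≤ t := by rwa [le_div_iff₀ hcpos] at hm_le
  have hf2ge : t ≤ ((m + 1 : ℤ) : ℚ) * c := by push_cast; rw [div_lt_iff₀ hcpos] at hm_lt; linarith
  rw [abs_of_nonneg (by linarith : 0 ≤ t - m * c)] at e1
  rw [abs_of_nonpos (by linarith : t - ((m + 1 : ℤ) : ℚ) * c ≤ 0)] at e2
  rw [abs_of_nonneg (by linarith : 0 ≤ t - 2 ^ k)] at eg
  push_cast at e2
  -- |e| ≤ c/2 = u · 2^k and |e| ≤ t - 2^k
  have hu : unitRoundoff p * (2 : ℚ) ^ k = c / 2 := by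
    unfold unitRoundoff
    rw [hc, show (k + 1 - (p : ℤ)) = k + 1 + (-(p : ℤ)) by ring, zpow_add₀ h2, zpow_add₀ h2,
      zpow_neg, zpow_natCast, zpow_one]
    field_simp
  have hupos : 0 < unitRoundoff p := by unfold unitRoundoff; positivity
  have hb : |t - fl t| ≤ unitRoundoff p * 2 ^ k := by rw [hu]; linarith
  -- combine: e (1 + u) ≤ u t
  rw [div_mul_eq_mul_div, le_div_iff₀ (by linarith)]
  have := mul_le_mul_of_nonneg_left eg hupos.le
  nlinarith

/-- OPTIMAL BOUND FOR ADDITION WITH UNDERFLOW: for `a, b ∈ F` and any round-to-nearest `fl`,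
`|fl(a+b) - (a+b)| ≤ u/(1+u) · |a+b|`. [cite: JeannerodRump2018, eq. (4.1)] -/
theorem abs_err_add_le_sharp {p : ℕ} {emin : ℤ} {fl : ℚ → ℚ} (hp : 1 ≤ p)
    (hfl : IsRoundNearest p emin fl) {a b : ℚ} (ha : IsFloat p emin a) (hb : IsFloat p emin b) :
    |fl (a + b) - (a + b)| ≤ unitRoundoff p / (1 + unitRoundoff p) * |a + b| := by
  set t := a + b with ht
  have hupos : 0 < unitRoundoff p := by unfold unitRoundoff; positivity
  by_cases hsmall : |t| < (2 : ℚ) ^ (emin + p)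
  · rw [fl_eq_self hfl (isFloat_add_of_small ha hb hsmall), sub_self, abs_zero]
    exact mul_nonneg (div_nonneg hupos.le (by linarith)) (abs_nonneg _)
  · have hbig : (2 : ℚ) ^ (emin + p) ≤ |t| := not_lt.mp hsmall
    rcases lt_or_ge t 0 with hneg | hnn
    · -- mirror
      have h := abs_sub_fl_le_sharp_pos hp hfl.neg (t := -t) (by rwa [abs_of_neg hneg] at hbig)
      simp only [neg_neg] at h
      rw [abs_of_neg hneg, abs_sub_comm]
      rw [show |t - fl t| = |-t - -fl t| by rw [← abs_neg]; ring_nf]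
      exact h
    · have h := abs_sub_fl_le_sharp_pos hp hfl (t := t) (by rwa [abs_of_nonneg hnn] at hbig)
      rw [abs_of_nonneg hnn, abs_sub_comm]; exact h

end Literature.ComputerArithmetic.JeannerodRump2018
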